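import Mathlib
import HarnessLib

/-!
# Route `KLProgramme` — a `C⁴` curve inside a level set: the differentiated level identities to ORDER FOUR (Faà di Bruno along the
# curve, nested Fréchet derivatives) and their pointwise solution for the top radial coefficient

Cell `gate-hubbard-kl`, seat hubbard-kl-k3c3-p3 (g2; row «implicit-function / monotonicity route»).  Crux K3 of route `KLProgramme`:
the ENGINE child (stmt-HubbardSuperconductivity-19823, `stub_twoLeg_step` / `stub_twoLeg_scale0`) must certify the angular clause (E3g)
`TwoLegAngularG` (`|∂_θ^j ν_n(K)(θ)| ≤ angBar … j`, `1 ≤ j ≤ 4`) and the tier-2 sizes (E3a-G) of objects READ ON THE FRAME'S FERMI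
CURVE, `ν_n(K)(θ) = F_n.eval (klFermiPoint μ K θ)`; every such proof meets the angular derivatives of the curve map
`θ ↦ klFermiPoint μ K θ = u_K(θ)·dir θ` up to order `4`, QUANTITATIVELY (plan g10, STATUS 2026-08-26T17:26:06Z (2): «the
implicit-function smoothness of `klFermiPoint μ K ·` … is CHILD-2/FRAME-SIDE work, stated once and cited by the engine»).  The tree has
order 1 (`abs_deriv_le`, p4), order 2 (`abs_second_deriv_le`, p4 lineage) and `C^∞` qualitatively (`contDiff_of_isRoot`).  This module is
the abstract core of orders 3 and 4 (companion `KLProgrammePerturbedFermiCurveHigherDerivs.lean` specialises to polar curves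
`θ ↦ u θ • dir θ` and assembles `|u″|, |u‴|, |u⁗|`):

* §1 POINTWISE ALGEBRA on a real normed space `V`.  If continuous (multi)linear functionals `A₁, …, A₄` and vectors `v₁, …, v₄` satisfy
  the differentiated level identity of order `m` (the shapes of §2) and `v_m = s • d + r` with `A₁ d ≥ ρ₀ > 0`, then
  `|s| ≤ (E₂K₁² + E₁L)/ρ₀` (m = 2), `|s| ≤ (E₃K₁³ + 3E₂K₁K₂ + E₁L)/ρ₀` (m = 3),
  `|s| ≤ (E₄K₁⁴ + 6E₃K₁²K₂ + 3E₂K₂² + 4E₂K₁K₃ + E₁L)/ρ₀` (m = 4) — the Faà di Bruno coefficients `1, 6, 3, 4`; AFFINE in the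
  top-order norms `E₃, E₄` (the orders a frame of class `FrameOK … N` lets grow like `4^N`, `4^{2N}`) — from `‖Aᵢ‖ ≤ Eᵢ`, `‖vᵢ‖ ≤ Kᵢ`,
  `‖r‖ ≤ L`.
* §2 THE CHAIN.  For `e : V → ℝ` of class `Cᵐ` and a curve `k₀ : ℝ → V` with derivative tower `k₁, …, k_m` (`HasDerivAt k_i (k_{i+1} ϑ) ϑ`)
  inside a level set `{e = c}`: `De[k₁] = 0`, `D²e[k₁,k₁] + De[k₂] = 0`,
  `D³e[k₁,k₁,k₁] + D²e[k₂,k₁] + D²e[k₁,k₂] + (D²e[k₁,k₂] + De[k₃]) = 0` (terms in the order the product rule produces them) and the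
  fifteen-term order-4 identity (`level_chain_one/two/three/four`) — by `HasDerivAt.clm_apply` on the nested Fréchet derivatives
  `fderiv ℝ (fderiv ℝ … e)` composed with the curve, and uniqueness of the derivative of a constant function.

Everything is PROVED; no definitions, nothing about the Hubbard model.  References: BGM 2006 §2.4 Lemma 2.1 (2.40) `|∂ⁿ_θ u(θ)| ≤ Cₙ`
[cite: BenfattoGiulianiMastropietro2006]; HOME/prover-p4/INVERSION-NOTE.md Lemma I (ii)–(iii).
-/

noncomputable section

namespace Summit.HubbardSuperconductivity.HubbardSuperconductivity.Theorems.PerturbedFermiCurve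

set_option linter.dupNamespace false -- summit = problem name (single-conjunct summit), D-0017
set_option maxSynthPendingDepth 3 -- nested operator-norm instances `V →L V →L V →L ℝ` (third/fourth Fréchet derivatives)

open Real Set

/-! ## §1 Pointwise algebra: solving the differentiated level identities for the top radial coefficient -/

section Algebra

variable {V : Type*} [NormedAddCommGroup V] [NormedSpace ℝ V]

/-- `|A v| ≤ E ‖v‖` for a functional of norm `≤ E`. [folklore] -/
theorem abs_apply_le_of_opNorm_le (A : V →L[ℝ] ℝ) {E : ℝ} (hE : ‖A‖ ≤ E) (v : V) : |A v| ≤ E * ‖v‖ := by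
  rw [← Real.norm_eq_abs]; exact A.le_of_opNorm_le hE v

/-- `|A v w| ≤ E ‖v‖ ‖w‖` for a bilinear functional of norm `≤ E`. [folklore] -/
theorem abs_apply₂_le_of_opNorm_le (A : V →L[ℝ] V →L[ℝ] ℝ) {E : ℝ} (hE : ‖A‖ ≤ E) (v w : V) :
    |A v w| ≤ E * ‖v‖ * ‖w‖ := by
  rw [← Real.norm_eq_abs]; exact (A v).le_of_opNorm_le (A.le_of_opNorm_le hE v) w

/-- `|A v w x| ≤ E ‖v‖ ‖w‖ ‖x‖` for a trilinear functional of norm `≤ E`. [folklore] -/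
theorem abs_apply₃_le_of_opNorm_le (A : V →L[ℝ] V →L[ℝ] V →L[ℝ] ℝ) {E : ℝ} (hE : ‖A‖ ≤ E) (v w x : V) :
    |A v w x| ≤ E * ‖v‖ * ‖w‖ * ‖x‖ := by
  rw [← Real.norm_eq_abs]; exact (A v w).le_of_opNorm_le ((A v).le_of_opNorm_le (A.le_of_opNorm_le hE v) w) x

/-- `|A v w x y| ≤ E ‖v‖ ‖w‖ ‖x‖ ‖y‖` for a quadrilinear functional of norm `≤ E`. [folklore] -/
theorem abs_apply₄_le_of_opNorm_le (A : V →L[ℝ] V →L[ℝ] V →L[ℝ] V →L[ℝ] ℝ) {E : ℝ} (hE : ‖A‖ ≤ E) (v w x y : V) :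
    |A v w x y| ≤ E * ‖v‖ * ‖w‖ * ‖x‖ * ‖y‖ := by
  rw [← Real.norm_eq_abs]
  exact (A v w x).le_of_opNorm_le ((A v w).le_of_opNorm_le ((A v).le_of_opNorm_le (A.le_of_opNorm_le hE v) w) x) y

/-- `|x + y| ≤ a + b` from `|x| ≤ a`, `|y| ≤ b`. [folklore] -/
theorem abs_add_le_add {x y a b : ℝ} (hx : |x| ≤ a) (hy : |y| ≤ b) : |x + y| ≤ a + b :=
  (abs_add_le x y).trans (add_le_add hx hy)

/-- **The radial solve.**  If `s·(A₁ d) = -T` with `A₁ d ≥ ρ₀ > 0` and `|T| ≤ M`, then `|s| ≤ M/ρ₀`. [folklore] -/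
theorem abs_le_div_of_mul_eq_neg {A : V →L[ℝ] ℝ} {d : V} {s T M ρ₀ : ℝ} (h : s * A d = -T) (hρ : ρ₀ ≤ A d) (hρ0 : 0 < ρ₀)
    (hM : |T| ≤ M) : |s| ≤ M / ρ₀ := by
  rw [le_div_iff₀ hρ0]
  have h1 : |s| * ρ₀ ≤ |s| * A d := mul_le_mul_of_nonneg_left hρ (abs_nonneg s)
  have h2 : |s| * A d = |T| := by
    rw [← abs_of_pos (hρ0.trans_le hρ), ← abs_mul, h, abs_neg]
  linarith

/-- **Order 2, pointwise.**  From `A₂[v₁,v₁] + A₁[v₂] = 0`, `v₂ = s • d + r`, `A₁ d ≥ ρ₀ > 0`: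
`|s| ≤ (E₂K₁² + E₁L)/ρ₀`. [folklore] -/
theorem abs_top_le_of_level_two (A₁ : V →L[ℝ] ℝ) (A₂ : V →L[ℝ] V →L[ℝ] ℝ) {v₁ v₂ d r : V} {s ρ₀ E₁ E₂ K₁ L : ℝ}
    (hid : A₂ v₁ v₁ + A₁ v₂ = 0) (hv : v₂ = s • d + r) (hρ : ρ₀ ≤ A₁ d) (hρ0 : 0 < ρ₀)
    (hE₁ : ‖A₁‖ ≤ E₁) (hE₂ : ‖A₂‖ ≤ E₂) (hK₁ : ‖v₁‖ ≤ K₁) (hL : ‖r‖ ≤ L) :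
    |s| ≤ (E₂ * K₁ ^ 2 + E₁ * L) / ρ₀ := by
  have hE₁0 : 0 ≤ E₁ := A₁.opNorm_nonneg.trans hE₁
  have hE₂0 : 0 ≤ E₂ := A₂.opNorm_nonneg.trans hE₂
  have hK₁0 : 0 ≤ K₁ := (norm_nonneg _).trans hK₁
  rw [hv, map_add, map_smul, smul_eq_mul] at hid
  have h : s * A₁ d = -(A₂ v₁ v₁ + A₁ r) := by linarith
  refine abs_le_div_of_mul_eq_neg h hρ hρ0 (abs_add_le_add ?_ ?_)
  · calc |A₂ v₁ v₁| ≤ E₂ * ‖v₁‖ * ‖v₁‖ := abs_apply₂_le_of_opNorm_le A₂ hE₂ v₁ v₁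
      _ ≤ E₂ * K₁ * K₁ := by gcongr
      _ = E₂ * K₁ ^ 2 := by ring
  · calc |A₁ r| ≤ E₁ * ‖r‖ := abs_apply_le_of_opNorm_le A₁ hE₁ r
      _ ≤ E₁ * L := by gcongr

/-- **Order 3, pointwise.**  From the order-3 identity `A₃[v₁,v₁,v₁] + A₂[v₂,v₁] + A₂[v₁,v₂] + (A₂[v₁,v₂] + A₁[v₃]) = 0` (the shape of
`level_chain_three`), `v₃ = s • d + r`, `A₁ d ≥ ρ₀ > 0`: `|s| ≤ (E₃K₁³ + 3E₂K₁K₂ + E₁L)/ρ₀`. [folklore] -/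
theorem abs_top_le_of_level_three (A₁ : V →L[ℝ] ℝ) (A₂ : V →L[ℝ] V →L[ℝ] ℝ) (A₃ : V →L[ℝ] V →L[ℝ] V →L[ℝ] ℝ)
    {v₁ v₂ v₃ d r : V} {s ρ₀ E₁ E₂ E₃ K₁ K₂ L : ℝ}
    (hid : A₃ v₁ v₁ v₁ + A₂ v₂ v₁ + A₂ v₁ v₂ + (A₂ v₁ v₂ + A₁ v₃) = 0) (hv : v₃ = s • d + r) (hρ : ρ₀ ≤ A₁ d)
    (hρ0 : 0 < ρ₀) (hE₁ : ‖A₁‖ ≤ E₁) (hE₂ : ‖A₂‖ ≤ E₂) (hE₃ : ‖A₃‖ ≤ E₃) (hK₁ : ‖v₁‖ ≤ K₁) (hK₂ : ‖v₂‖ ≤ K₂)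
    (hL : ‖r‖ ≤ L) :
    |s| ≤ (E₃ * K₁ ^ 3 + 3 * E₂ * K₁ * K₂ + E₁ * L) / ρ₀ := by
  have hE₁0 : 0 ≤ E₁ := A₁.opNorm_nonneg.trans hE₁
  have hE₂0 : 0 ≤ E₂ := A₂.opNorm_nonneg.trans hE₂
  have hE₃0 : 0 ≤ E₃ := A₃.opNorm_nonneg.trans hE₃
  have hK₁0 : 0 ≤ K₁ := (norm_nonneg _).trans hK₁
  have hK₂0 : 0 ≤ K₂ := (norm_nonneg _).trans hK₂
  rw [hv, map_add, map_smul, smul_eq_mul] at hid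
  have h : s * A₁ d = -(A₃ v₁ v₁ v₁ + A₂ v₂ v₁ + A₂ v₁ v₂ + A₂ v₁ v₂ + A₁ r) := by linarith
  have h21 : |A₂ v₂ v₁| ≤ E₂ * K₁ * K₂ := by
    calc |A₂ v₂ v₁| ≤ E₂ * ‖v₂‖ * ‖v₁‖ := abs_apply₂_le_of_opNorm_le A₂ hE₂ v₂ v₁
      _ ≤ E₂ * K₂ * K₁ := by gcongr
      _ = E₂ * K₁ * K₂ := by ring
  have h12 : |A₂ v₁ v₂| ≤ E₂ * K₁ * K₂ := by
    calc |A₂ v₁ v₂| ≤ E₂ * ‖v₁‖ * ‖v₂‖ := abs_apply₂_le_of_opNorm_le A₂ hE₂ v₁ v₂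
      _ ≤ E₂ * K₁ * K₂ := by gcongr
  have h3 : |A₃ v₁ v₁ v₁| ≤ E₃ * K₁ ^ 3 := by
    calc |A₃ v₁ v₁ v₁| ≤ E₃ * ‖v₁‖ * ‖v₁‖ * ‖v₁‖ := abs_apply₃_le_of_opNorm_le A₃ hE₃ v₁ v₁ v₁
      _ ≤ E₃ * K₁ * K₁ * K₁ := by gcongr
      _ = E₃ * K₁ ^ 3 := by ring
  have hr : |A₁ r| ≤ E₁ * L := by
    calc |A₁ r| ≤ E₁ * ‖r‖ := abs_apply_le_of_opNorm_le A₁ hE₁ r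
      _ ≤ E₁ * L := by gcongr
  have hM := abs_add_le_add (abs_add_le_add (abs_add_le_add (abs_add_le_add h3 h21) h12) h12) hr
  refine abs_le_div_of_mul_eq_neg h hρ hρ0 (hM.trans (le_of_eq ?_))
  ring

/-- **Order 4, pointwise.**  From the order-4 identity (the 15-term shape of `level_chain_four`), `v₄ = s • d + r`, `A₁ d ≥ ρ₀ > 0`:
`|s| ≤ (E₄K₁⁴ + 6E₃K₁²K₂ + 3E₂K₂² + 4E₂K₁K₃ + E₁L)/ρ₀` (Faà di Bruno coefficients `1, 6, 3, 4`). [folklore] -/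
theorem abs_top_le_of_level_four (A₁ : V →L[ℝ] ℝ) (A₂ : V →L[ℝ] V →L[ℝ] ℝ) (A₃ : V →L[ℝ] V →L[ℝ] V →L[ℝ] ℝ)
    (A₄ : V →L[ℝ] V →L[ℝ] V →L[ℝ] V →L[ℝ] ℝ) {v₁ v₂ v₃ v₄ d r : V} {s ρ₀ E₁ E₂ E₃ E₄ K₁ K₂ K₃ L : ℝ}
    (hid : A₄ v₁ v₁ v₁ v₁ + A₃ v₂ v₁ v₁ + A₃ v₁ v₂ v₁ + A₃ v₁ v₁ v₂ + (A₃ v₁ v₂ v₁ + A₂ v₃ v₁ + A₂ v₂ v₂) +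
        (A₃ v₁ v₁ v₂ + A₂ v₂ v₂ + A₂ v₁ v₃) + (A₃ v₁ v₁ v₂ + A₂ v₂ v₂ + A₂ v₁ v₃) + (A₂ v₁ v₃ + A₁ v₄) = 0)
    (hv : v₄ = s • d + r) (hρ : ρ₀ ≤ A₁ d) (hρ0 : 0 < ρ₀)
    (hE₁ : ‖A₁‖ ≤ E₁) (hE₂ : ‖A₂‖ ≤ E₂) (hE₃ : ‖A₃‖ ≤ E₃) (hE₄ : ‖A₄‖ ≤ E₄)
    (hK₁ : ‖v₁‖ ≤ K₁) (hK₂ : ‖v₂‖ ≤ K₂) (hK₃ : ‖v₃‖ ≤ K₃) (hL : ‖r‖ ≤ L) :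
    |s| ≤ (E₄ * K₁ ^ 4 + 6 * E₃ * K₁ ^ 2 * K₂ + 3 * E₂ * K₂ ^ 2 + 4 * E₂ * K₁ * K₃ + E₁ * L) / ρ₀ := by
  have hE₁0 : 0 ≤ E₁ := A₁.opNorm_nonneg.trans hE₁
  have hE₂0 : 0 ≤ E₂ := A₂.opNorm_nonneg.trans hE₂
  have hE₃0 : 0 ≤ E₃ := A₃.opNorm_nonneg.trans hE₃
  have hE₄0 : 0 ≤ E₄ := A₄.opNorm_nonneg.trans hE₄
  have hK₁0 : 0 ≤ K₁ := (norm_nonneg _).trans hK₁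
  have hK₂0 : 0 ≤ K₂ := (norm_nonneg _).trans hK₂
  have hK₃0 : 0 ≤ K₃ := (norm_nonneg _).trans hK₃
  rw [hv, map_add, map_smul, smul_eq_mul] at hid
  have h : s * A₁ d = -(A₄ v₁ v₁ v₁ v₁ + A₃ v₂ v₁ v₁ + A₃ v₁ v₂ v₁ + A₃ v₁ v₁ v₂ + (A₃ v₁ v₂ v₁ + A₂ v₃ v₁ + A₂ v₂ v₂) +
        (A₃ v₁ v₁ v₂ + A₂ v₂ v₂ + A₂ v₁ v₃) + (A₃ v₁ v₁ v₂ + A₂ v₂ v₂ + A₂ v₁ v₃) + A₂ v₁ v₃ + A₁ r) := by linarith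
  -- the fifteen term bounds
  have h4 : |A₄ v₁ v₁ v₁ v₁| ≤ E₄ * K₁ ^ 4 := by
    calc |A₄ v₁ v₁ v₁ v₁| ≤ E₄ * ‖v₁‖ * ‖v₁‖ * ‖v₁‖ * ‖v₁‖ := abs_apply₄_le_of_opNorm_le A₄ hE₄ v₁ v₁ v₁ v₁
      _ ≤ E₄ * K₁ * K₁ * K₁ * K₁ := by gcongr
      _ = E₄ * K₁ ^ 4 := by ring
  have h3a : |A₃ v₂ v₁ v₁| ≤ E₃ * K₁ ^ 2 * K₂ := by
    calc |A₃ v₂ v₁ v₁| ≤ E₃ * ‖v₂‖ * ‖v₁‖ * ‖v₁‖ := abs_apply₃_le_of_opNorm_le A₃ hE₃ v₂ v₁ v₁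
      _ ≤ E₃ * K₂ * K₁ * K₁ := by gcongr
      _ = E₃ * K₁ ^ 2 * K₂ := by ring
  have h3b : |A₃ v₁ v₂ v₁| ≤ E₃ * K₁ ^ 2 * K₂ := by
    calc |A₃ v₁ v₂ v₁| ≤ E₃ * ‖v₁‖ * ‖v₂‖ * ‖v₁‖ := abs_apply₃_le_of_opNorm_le A₃ hE₃ v₁ v₂ v₁
      _ ≤ E₃ * K₁ * K₂ * K₁ := by gcongr
      _ = E₃ * K₁ ^ 2 * K₂ := by ring
  have h3c : |A₃ v₁ v₁ v₂| ≤ E₃ * K₁ ^ 2 * K₂ := by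
    calc |A₃ v₁ v₁ v₂| ≤ E₃ * ‖v₁‖ * ‖v₁‖ * ‖v₂‖ := abs_apply₃_le_of_opNorm_le A₃ hE₃ v₁ v₁ v₂
      _ ≤ E₃ * K₁ * K₁ * K₂ := by gcongr
      _ = E₃ * K₁ ^ 2 * K₂ := by ring
  have h22 : |A₂ v₂ v₂| ≤ E₂ * K₂ ^ 2 := by
    calc |A₂ v₂ v₂| ≤ E₂ * ‖v₂‖ * ‖v₂‖ := abs_apply₂_le_of_opNorm_le A₂ hE₂ v₂ v₂
      _ ≤ E₂ * K₂ * K₂ := by gcongr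
      _ = E₂ * K₂ ^ 2 := by ring
  have h31 : |A₂ v₃ v₁| ≤ E₂ * K₁ * K₃ := by
    calc |A₂ v₃ v₁| ≤ E₂ * ‖v₃‖ * ‖v₁‖ := abs_apply₂_le_of_opNorm_le A₂ hE₂ v₃ v₁
      _ ≤ E₂ * K₃ * K₁ := by gcongr
      _ = E₂ * K₁ * K₃ := by ring
  have h13 : |A₂ v₁ v₃| ≤ E₂ * K₁ * K₃ := by
    calc |A₂ v₁ v₃| ≤ E₂ * ‖v₁‖ * ‖v₃‖ := abs_apply₂_le_of_opNorm_le A₂ hE₂ v₁ v₃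
      _ ≤ E₂ * K₁ * K₃ := by gcongr
  have hr : |A₁ r| ≤ E₁ * L := by
    calc |A₁ r| ≤ E₁ * ‖r‖ := abs_apply_le_of_opNorm_le A₁ hE₁ r
      _ ≤ E₁ * L := by gcongr
  have hM := abs_add_le_add (abs_add_le_add (abs_add_le_add (abs_add_le_add (abs_add_le_add (abs_add_le_add
    (abs_add_le_add (abs_add_le_add h4 h3a) h3b) h3c) (abs_add_le_add (abs_add_le_add h3b h31) h22))
    (abs_add_le_add (abs_add_le_add h3c h22) h13)) (abs_add_le_add (abs_add_le_add h3c h22) h13)) h13) hr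
  refine abs_le_div_of_mul_eq_neg h hρ hρ0 (hM.trans (le_of_eq ?_))
  ring

end Algebra

/-! ## §2 The chain: differentiated level identities along a `C⁴` curve inside a level set -/

section Chain

variable {V : Type*} [NormedAddCommGroup V] [NormedSpace ℝ V] {e : V → ℝ} {c : ℝ} {k₀ k₁ k₂ k₃ k₄ : ℝ → V}

/-- **Order 1**: `De(k₀)[k₁] = 0` along a differentiable curve inside `{e = c}`. [folklore] -/
theorem level_chain_one (he : ContDiff ℝ 1 e) (hlev : ∀ ϑ, e (k₀ ϑ) = c) (hk₀ : ∀ ϑ, HasDerivAt k₀ (k₁ ϑ) ϑ) (θ : ℝ) :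
    fderiv ℝ e (k₀ θ) (k₁ θ) = 0 := by
  have hF : HasFDerivAt e (fderiv ℝ e (k₀ θ)) (k₀ θ) := ((he.differentiable one_ne_zero) _).hasFDerivAt
  have hcomp : HasDerivAt (e ∘ k₀) (fderiv ℝ e (k₀ θ) (k₁ θ)) θ := hF.comp_hasDerivAt θ (hk₀ θ)
  have hconst : HasDerivAt (e ∘ k₀) 0 θ := by
    have : (e ∘ k₀) = fun _ => c := funext hlev
    rw [this]; exact hasDerivAt_const θ c
  exact hcomp.unique hconst

/-- **Order 2**: `D²e(k₀)[k₁,k₁] + De(k₀)[k₂] = 0`. [folklore] -/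
theorem level_chain_two (he : ContDiff ℝ 2 e) (hlev : ∀ ϑ, e (k₀ ϑ) = c) (hk₀ : ∀ ϑ, HasDerivAt k₀ (k₁ ϑ) ϑ)
    (hk₁ : ∀ ϑ, HasDerivAt k₁ (k₂ ϑ) ϑ) (θ : ℝ) :
    fderiv ℝ (fderiv ℝ e) (k₀ θ) (k₁ θ) (k₁ θ) + fderiv ℝ e (k₀ θ) (k₂ θ) = 0 := by
  have hT1 : (fun ϑ => fderiv ℝ e (k₀ ϑ) (k₁ ϑ)) = fun _ => (0 : ℝ) :=
    funext fun ϑ => level_chain_one (he.of_le (by norm_num)) hlev hk₀ ϑ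
  have he1 : ContDiff ℝ 1 (fderiv ℝ e) := he.fderiv_right (by norm_num)
  have hF1 : HasFDerivAt (fderiv ℝ e) (fderiv ℝ (fderiv ℝ e) (k₀ θ)) (k₀ θ) :=
    ((he1.differentiable one_ne_zero) _).hasFDerivAt
  have hc : HasDerivAt (fun ϑ => fderiv ℝ e (k₀ ϑ)) (fderiv ℝ (fderiv ℝ e) (k₀ θ) (k₁ θ)) θ :=
    hF1.comp_hasDerivAt θ (hk₀ θ)
  have hT : HasDerivAt (fun ϑ => fderiv ℝ e (k₀ ϑ) (k₁ ϑ))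
      (fderiv ℝ (fderiv ℝ e) (k₀ θ) (k₁ θ) (k₁ θ) + fderiv ℝ e (k₀ θ) (k₂ θ)) θ := hc.clm_apply (hk₁ θ)
  have hzero : HasDerivAt (fun ϑ => fderiv ℝ e (k₀ ϑ) (k₁ ϑ)) 0 θ := by
    rw [hT1]; exact hasDerivAt_const θ (0 : ℝ)
  exact hT.unique hzero

/-- **Order 3**: `D³e(k₀)[k₁,k₁,k₁] + D²e(k₀)[k₂,k₁] + D²e(k₀)[k₁,k₂] + (D²e(k₀)[k₁,k₂] + De(k₀)[k₃]) = 0` (terms in the order the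
product rule yields them; `3·D²e[k₁,k₂]` by symmetry, not used). [folklore] -/
theorem level_chain_three (he : ContDiff ℝ 3 e) (hlev : ∀ ϑ, e (k₀ ϑ) = c) (hk₀ : ∀ ϑ, HasDerivAt k₀ (k₁ ϑ) ϑ)
    (hk₁ : ∀ ϑ, HasDerivAt k₁ (k₂ ϑ) ϑ) (hk₂ : ∀ ϑ, HasDerivAt k₂ (k₃ ϑ) ϑ) (θ : ℝ) :
    fderiv ℝ (fderiv ℝ (fderiv ℝ e)) (k₀ θ) (k₁ θ) (k₁ θ) (k₁ θ) + fderiv ℝ (fderiv ℝ e) (k₀ θ) (k₂ θ) (k₁ θ) +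
        fderiv ℝ (fderiv ℝ e) (k₀ θ) (k₁ θ) (k₂ θ) +
      (fderiv ℝ (fderiv ℝ e) (k₀ θ) (k₁ θ) (k₂ θ) + fderiv ℝ e (k₀ θ) (k₃ θ)) = 0 := by
  have hT2 : (fun ϑ => fderiv ℝ (fderiv ℝ e) (k₀ ϑ) (k₁ ϑ) (k₁ ϑ) + fderiv ℝ e (k₀ ϑ) (k₂ ϑ)) = fun _ => (0 : ℝ) :=
    funext fun ϑ => level_chain_two (he.of_le (by norm_num)) hlev hk₀ hk₁ ϑ
  have he1 : ContDiff ℝ 2 (fderiv ℝ e) := he.fderiv_right (by norm_num)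
  have he2 : ContDiff ℝ 1 (fderiv ℝ (fderiv ℝ e)) := he1.fderiv_right (by norm_num)
  have hF1 : HasFDerivAt (fderiv ℝ e) (fderiv ℝ (fderiv ℝ e) (k₀ θ)) (k₀ θ) :=
    ((he1.differentiable (by norm_num)) _).hasFDerivAt
  have hF2 : HasFDerivAt (fderiv ℝ (fderiv ℝ e)) (fderiv ℝ (fderiv ℝ (fderiv ℝ e)) (k₀ θ)) (k₀ θ) :=
    ((he2.differentiable one_ne_zero) _).hasFDerivAt
  have hc1 : HasDerivAt (fun ϑ => fderiv ℝ e (k₀ ϑ)) (fderiv ℝ (fderiv ℝ e) (k₀ θ) (k₁ θ)) θ :=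
    hF1.comp_hasDerivAt θ (hk₀ θ)
  have hc2 : HasDerivAt (fun ϑ => fderiv ℝ (fderiv ℝ e) (k₀ ϑ)) (fderiv ℝ (fderiv ℝ (fderiv ℝ e)) (k₀ θ) (k₁ θ)) θ :=
    hF2.comp_hasDerivAt θ (hk₀ θ)
  have hA := (hc2.clm_apply (hk₁ θ)).clm_apply (hk₁ θ)
  have hB := hc1.clm_apply (hk₂ θ)
  have hT := hA.add hB
  have hzero : HasDerivAt (fun ϑ => fderiv ℝ (fderiv ℝ e) (k₀ ϑ) (k₁ ϑ) (k₁ ϑ) + fderiv ℝ e (k₀ ϑ) (k₂ ϑ)) 0 θ := by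
    rw [hT2]; exact hasDerivAt_const θ (0 : ℝ)
  have h := hT.unique hzero
  simp only [add_apply] at h
  linarith [h]

/-- **Order 4**: the fifteen-term identity obtained by differentiating the order-3 identity once more along the curve
(`D⁴e[k₁⁴] + 6·D³e[k₂,k₁,k₁] + 3·D²e[k₂,k₂] + 4·D²e[k₃,k₁] + De[k₄] = 0` up to the symmetry of the derivatives, not used). [folklore] -/
theorem level_chain_four (he : ContDiff ℝ 4 e) (hlev : ∀ ϑ, e (k₀ ϑ) = c) (hk₀ : ∀ ϑ, HasDerivAt k₀ (k₁ ϑ) ϑ)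
    (hk₁ : ∀ ϑ, HasDerivAt k₁ (k₂ ϑ) ϑ) (hk₂ : ∀ ϑ, HasDerivAt k₂ (k₃ ϑ) ϑ) (hk₃ : ∀ ϑ, HasDerivAt k₃ (k₄ ϑ) ϑ) (θ : ℝ) :
    fderiv ℝ (fderiv ℝ (fderiv ℝ (fderiv ℝ e))) (k₀ θ) (k₁ θ) (k₁ θ) (k₁ θ) (k₁ θ) +
        fderiv ℝ (fderiv ℝ (fderiv ℝ e)) (k₀ θ) (k₂ θ) (k₁ θ) (k₁ θ) +
        fderiv ℝ (fderiv ℝ (fderiv ℝ e)) (k₀ θ) (k₁ θ) (k₂ θ) (k₁ θ) +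
        fderiv ℝ (fderiv ℝ (fderiv ℝ e)) (k₀ θ) (k₁ θ) (k₁ θ) (k₂ θ) +
      (fderiv ℝ (fderiv ℝ (fderiv ℝ e)) (k₀ θ) (k₁ θ) (k₂ θ) (k₁ θ) + fderiv ℝ (fderiv ℝ e) (k₀ θ) (k₃ θ) (k₁ θ) +
        fderiv ℝ (fderiv ℝ e) (k₀ θ) (k₂ θ) (k₂ θ)) +
      (fderiv ℝ (fderiv ℝ (fderiv ℝ e)) (k₀ θ) (k₁ θ) (k₁ θ) (k₂ θ) + fderiv ℝ (fderiv ℝ e) (k₀ θ) (k₂ θ) (k₂ θ) +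
        fderiv ℝ (fderiv ℝ e) (k₀ θ) (k₁ θ) (k₃ θ)) +
      (fderiv ℝ (fderiv ℝ (fderiv ℝ e)) (k₀ θ) (k₁ θ) (k₁ θ) (k₂ θ) + fderiv ℝ (fderiv ℝ e) (k₀ θ) (k₂ θ) (k₂ θ) +
        fderiv ℝ (fderiv ℝ e) (k₀ θ) (k₁ θ) (k₃ θ)) +
      (fderiv ℝ (fderiv ℝ e) (k₀ θ) (k₁ θ) (k₃ θ) + fderiv ℝ e (k₀ θ) (k₄ θ)) = 0 := by
  have hT3 : (fun ϑ => fderiv ℝ (fderiv ℝ (fderiv ℝ e)) (k₀ ϑ) (k₁ ϑ) (k₁ ϑ) (k₁ ϑ) +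
        fderiv ℝ (fderiv ℝ e) (k₀ ϑ) (k₂ ϑ) (k₁ ϑ) + fderiv ℝ (fderiv ℝ e) (k₀ ϑ) (k₁ ϑ) (k₂ ϑ) +
      (fderiv ℝ (fderiv ℝ e) (k₀ ϑ) (k₁ ϑ) (k₂ ϑ) + fderiv ℝ e (k₀ ϑ) (k₃ ϑ))) = fun _ => (0 : ℝ) :=
    funext fun ϑ => level_chain_three (he.of_le (by norm_num)) hlev hk₀ hk₁ hk₂ ϑ
  have he1 : ContDiff ℝ 3 (fderiv ℝ e) := he.fderiv_right (by norm_num)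
  have he2 : ContDiff ℝ 2 (fderiv ℝ (fderiv ℝ e)) := he1.fderiv_right (by norm_num)
  have he3 : ContDiff ℝ 1 (fderiv ℝ (fderiv ℝ (fderiv ℝ e))) := he2.fderiv_right (by norm_num)
  have hF1 : HasFDerivAt (fderiv ℝ e) (fderiv ℝ (fderiv ℝ e) (k₀ θ)) (k₀ θ) :=
    ((he1.differentiable (by norm_num)) _).hasFDerivAt
  have hF2 : HasFDerivAt (fderiv ℝ (fderiv ℝ e)) (fderiv ℝ (fderiv ℝ (fderiv ℝ e)) (k₀ θ)) (k₀ θ) :=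
    ((he2.differentiable (by norm_num)) _).hasFDerivAt
  have hF3 : HasFDerivAt (fderiv ℝ (fderiv ℝ (fderiv ℝ e))) (fderiv ℝ (fderiv ℝ (fderiv ℝ (fderiv ℝ e))) (k₀ θ)) (k₀ θ) :=
    ((he3.differentiable one_ne_zero) _).hasFDerivAt
  have hc1 : HasDerivAt (fun ϑ => fderiv ℝ e (k₀ ϑ)) (fderiv ℝ (fderiv ℝ e) (k₀ θ) (k₁ θ)) θ :=
    hF1.comp_hasDerivAt θ (hk₀ θ)
  have hc2 : HasDerivAt (fun ϑ => fderiv ℝ (fderiv ℝ e) (k₀ ϑ)) (fderiv ℝ (fderiv ℝ (fderiv ℝ e)) (k₀ θ) (k₁ θ)) θ :=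
    hF2.comp_hasDerivAt θ (hk₀ θ)
  have hc3 : HasDerivAt (fun ϑ => fderiv ℝ (fderiv ℝ (fderiv ℝ e)) (k₀ ϑ))
      (fderiv ℝ (fderiv ℝ (fderiv ℝ (fderiv ℝ e))) (k₀ θ) (k₁ θ)) θ := hF3.comp_hasDerivAt θ (hk₀ θ)
  -- the five terms of the order-3 identity, differentiated
  have h1 := ((hc3.clm_apply (hk₁ θ)).clm_apply (hk₁ θ)).clm_apply (hk₁ θ)
  have h2 := (hc2.clm_apply (hk₂ θ)).clm_apply (hk₁ θ)
  have h3 := (hc2.clm_apply (hk₁ θ)).clm_apply (hk₂ θ)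
  have h5 := hc1.clm_apply (hk₃ θ)
  have hT := ((h1.add h2).add h3).add (h3.add h5)
  have hzero : HasDerivAt (fun ϑ => fderiv ℝ (fderiv ℝ (fderiv ℝ e)) (k₀ ϑ) (k₁ ϑ) (k₁ ϑ) (k₁ ϑ) +
        fderiv ℝ (fderiv ℝ e) (k₀ ϑ) (k₂ ϑ) (k₁ ϑ) + fderiv ℝ (fderiv ℝ e) (k₀ ϑ) (k₁ ϑ) (k₂ ϑ) +
      (fderiv ℝ (fderiv ℝ e) (k₀ ϑ) (k₁ ϑ) (k₂ ϑ) + fderiv ℝ e (k₀ ϑ) (k₃ ϑ))) 0 θ := by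
    rw [hT3]; exact hasDerivAt_const θ (0 : ℝ)
  have h := hT.unique hzero
  simp only [add_apply] at h
  linarith [h]

end Chain

end Summit.HubbardSuperconductivity.HubbardSuperconductivity.Theorems.PerturbedFermiCurve

end
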